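import Mathlib.Analysis.SpecialFunctions.Pow.Real
import Mathlib.Analysis.SpecialFunctions.Sqrt
import Mathlib.Algebra.Order.BigOperators.Group.Finset
import Mathlib.Order.Interval.Finset.Nat

/-!
# Entropy bound for tangent states: the Chebyshev–pigeonhole–push lower bound for a point mass (line `FirstLemma`, crux stmt-AtomisticToContinuum-14135)

Helper file of the registered stub `c9_pointMass_ge_of_chebyshev_push` (lead seat c9, Gibbs route of the uniform
entropy bound, thermodynamic step), namespace
`Summit.AtomisticToContinuum.HydrodynamicLimit.Theorems.KiferCompactification`. Pure real analysis of finite sums;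
Mathlib only.

In the Gibbs route the canonical ensemble forces an EXACT particle number in each blown-up cell, and the free
finite-volume hard-sphere measure must give that exact count a probability that is not exponentially small in the
cell volume. Abstractly: `p j ≥ 0` is the probability of `j` particles (a law on `ℕ` carried by `{0, …, K}`), `m` a
centre (the mean `∑ i, i * p i` in the application), the second moment about `m` is at most `V`, and on a window
`lo ≤ j < hi` containing `[m - 2√V, m + 2√V]` the "insertion ratios" satisfy `r * p j ≤ p (j+1)` and
`r * p (j+1) ≤ p j` for a constant `0 < r ≤ 1`. Then every `k ∈ [lo, hi]` has
`p k ≥ 3 / (4 (4√V + 2)) * r ^ (hi - lo)`: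

* `c9_chebyshev_tail_sum_le` — Chebyshev: the mass of the `j` with `2√V < |j - m|` is at most `1/4`
  (for such `j`, `4V < (j - m)²`, so `4V * (tail mass) ≤ V`; the degenerate case `V = 0` is handled separately);
* `c9_card_le_of_forall_mem_Icc` — a finite set of naturals inside a real interval `[a, b]` has at most `b - a + 1`
  elements, whence the set `S` of `j ≤ K` with `|j - m| ≤ 2√V` has at most `4√V + 1 ≤ 4√V + 2` elements and
  (pigeonhole, `Finset.exists_max_image` + `Finset.sum_le_card_nsmul`) some `k₀ ∈ S` has
  `p k₀ ≥ (3/4) / (4√V + 2)`;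
* `c9_pow_mul_le_of_ratio_up` / `c9_pow_mul_le_of_ratio_down` — pushing along the ratio bounds:
  `r ^ n * p a ≤ p (a + n)` and `r ^ n * p (a + n) ≤ p a` for `lo ≤ a`, `a + n ≤ hi`;
* `c9_pointMass_ge_of_chebyshev_push'` — the bound for an arbitrary finite carrier `s` and centre `m`;
* `c9_pointMass_ge_of_chebyshev_push` — the registered signature (carrier `Finset.range (K+1)`, centre the mean).

Since `k₀, k ∈ [lo, hi]`, `|k - k₀| ≤ hi - lo` and `r ≤ 1` give `r ^ (hi - lo) * p k₀ ≤ r ^ |k - k₀| * p k₀ ≤ p k`.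
-/

namespace Summit.AtomisticToContinuum.HydrodynamicLimit.Theorems.KiferCompactification

/-- **Push up along ratio lower bounds.** If `r * p j ≤ p (j + 1)` for `lo ≤ j < hi` and `0 ≤ r`, then
`r ^ n * p a ≤ p (a + n)` whenever `lo ≤ a` and `a + n ≤ hi`. -/
theorem c9_pow_mul_le_of_ratio_up (p : ℕ → ℝ) {r : ℝ} (hr0 : 0 ≤ r) {lo hi : ℕ}
    (hratio : ∀ j, lo ≤ j → j < hi → r * p j ≤ p (j + 1)) {a : ℕ} (ha : lo ≤ a) :
    ∀ n : ℕ, a + n ≤ hi → r ^ n * p a ≤ p (a + n) := by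
  intro n
  induction n with
  | zero => intro _; simp
  | succ n ih =>
    intro hn
    have h1 : r ^ n * p a ≤ p (a + n) := ih (by omega)
    have h2 : r * p (a + n) ≤ p (a + n + 1) := hratio (a + n) (by omega) (by omega)
    calc r ^ (n + 1) * p a = r * (r ^ n * p a) := by ring
      _ ≤ r * p (a + n) := mul_le_mul_of_nonneg_left h1 hr0
      _ ≤ p (a + (n + 1)) := by rw [← add_assoc]; exact h2

/-- **Push down along ratio upper bounds.** If `r * p (j + 1) ≤ p j` for `lo ≤ j < hi` and `0 ≤ r`, then
`r ^ n * p (a + n) ≤ p a` whenever `lo ≤ a` and `a + n ≤ hi`. -/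
theorem c9_pow_mul_le_of_ratio_down (p : ℕ → ℝ) {r : ℝ} (hr0 : 0 ≤ r) {lo hi : ℕ}
    (hratio : ∀ j, lo ≤ j → j < hi → r * p (j + 1) ≤ p j) {a : ℕ} (ha : lo ≤ a) :
    ∀ n : ℕ, a + n ≤ hi → r ^ n * p (a + n) ≤ p a := by
  intro n
  induction n with
  | zero => intro _; simp
  | succ n ih =>
    intro hn
    have h1 : r ^ n * p (a + n) ≤ p a := ih (by omega)
    have h2 : r * p (a + n + 1) ≤ p (a + n) := hratio (a + n) (by omega) (by omega)
    calc r ^ (n + 1) * p (a + (n + 1)) = r ^ n * (r * p (a + n + 1)) := by rw [← add_assoc]; ring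
      _ ≤ r ^ n * p (a + n) := mul_le_mul_of_nonneg_left h2 (pow_nonneg hr0 n)
      _ ≤ p a := h1

/-- **Chebyshev for a finitely supported law on `ℕ`.** If `p ≥ 0` and `∑ j ∈ s, (j - m)² p j ≤ V` with `0 ≤ V`,
the `p`-mass of the `j ∈ s` with `2√V < |j - m|` is at most `1/4` (no normalisation of `p` is needed; for `V = 0`
the tail carries no mass at all). -/
theorem c9_chebyshev_tail_sum_le (s : Finset ℕ) (p : ℕ → ℝ) (hp0 : ∀ j, 0 ≤ p j) (m : ℝ) {V : ℝ}
    (hV0 : 0 ≤ V) (hV : ∑ j ∈ s, ((j : ℝ) - m) ^ 2 * p j ≤ V) :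
    ∑ j ∈ s.filter (fun j : ℕ => 2 * Real.sqrt V < |(j : ℝ) - m|), p j ≤ 1 / 4 := by
  set T := s.filter (fun j : ℕ => 2 * Real.sqrt V < |(j : ℝ) - m|) with hT
  have hTs : T ⊆ s := Finset.filter_subset _ _
  -- on the tail, `4 V < (j - m)²`
  have hsq : ∀ j ∈ T, 4 * V < ((j : ℝ) - m) ^ 2 := by
    intro j hj
    have hj' : 2 * Real.sqrt V < |(j : ℝ) - m| := (Finset.mem_filter.mp hj).2
    have h2 : 0 ≤ 2 * Real.sqrt V := by positivity
    have h3 : 2 * Real.sqrt V * (2 * Real.sqrt V) < |(j : ℝ) - m| * |(j : ℝ) - m| :=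
      mul_self_lt_mul_self h2 hj'
    have h4 : 2 * Real.sqrt V * (2 * Real.sqrt V) = 4 * V := by
      have := Real.mul_self_sqrt hV0
      linear_combination (2 : ℝ) * 2 * this
    rw [h4, abs_mul_abs_self] at h3
    linarith [h3]
  have hsumT : 4 * V * ∑ j ∈ T, p j ≤ V := by
    calc 4 * V * ∑ j ∈ T, p j = ∑ j ∈ T, 4 * V * p j := Finset.mul_sum _ _ _
      _ ≤ ∑ j ∈ T, ((j : ℝ) - m) ^ 2 * p j :=
        Finset.sum_le_sum fun j hj => mul_le_mul_of_nonneg_right (hsq j hj).le (hp0 j)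
      _ ≤ ∑ j ∈ s, ((j : ℝ) - m) ^ 2 * p j :=
        Finset.sum_le_sum_of_subset_of_nonneg hTs fun j _ _ => mul_nonneg (sq_nonneg _) (hp0 j)
      _ ≤ V := hV
  rcases hV0.lt_or_eq with hVpos | hV0'
  · -- `V > 0`: divide by `4 V`
    rw [le_div_iff₀ (by norm_num : (0 : ℝ) < 4)]
    nlinarith [hsumT, hVpos]
  · -- `V = 0`: every term of the second moment vanishes, so the tail carries no mass
    have hV' : V = 0 := hV0'.symm
    have hnn : ∀ j ∈ s, 0 ≤ ((j : ℝ) - m) ^ 2 * p j := fun j _ => mul_nonneg (sq_nonneg _) (hp0 j)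
    have hzero : ∑ j ∈ s, ((j : ℝ) - m) ^ 2 * p j = 0 :=
      le_antisymm (hV.trans_eq hV') (Finset.sum_nonneg hnn)
    rw [Finset.sum_eq_zero_iff_of_nonneg hnn] at hzero
    have hT0 : ∑ j ∈ T, p j = 0 := by
      refine Finset.sum_eq_zero fun j hj => ?_
      have h1 : ((j : ℝ) - m) ^ 2 * p j = 0 := hzero j (hTs hj)
      have h2 : 0 < ((j : ℝ) - m) ^ 2 := by
        have := hsq j hj
        rw [hV'] at this
        linarith
      rcases mul_eq_zero.mp h1 with h | h
      · exact absurd h h2.ne'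
      · exact h
    rw [hT0]
    norm_num

/-- **Integers in an interval.** A nonempty finite set of naturals all of whose elements lie in the real interval
`[a, b]` has at most `b - a + 1` elements. -/
theorem c9_card_le_of_forall_mem_Icc (S : Finset ℕ) (hS : S.Nonempty) {a b : ℝ}
    (h : ∀ j ∈ S, a ≤ (j : ℝ) ∧ (j : ℝ) ≤ b) : (S.card : ℝ) ≤ b - a + 1 := by
  set l := S.min' hS with hl
  set u := S.max' hS with hu
  have hsub : S ⊆ Finset.Icc l u := fun j hj => Finset.mem_Icc.mpr ⟨S.min'_le j hj, S.le_max' j hj⟩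
  have hcard : S.card ≤ u + 1 - l := (Finset.card_le_card hsub).trans_eq (Nat.card_Icc l u)
  have hlu : l ≤ u := S.min'_le u (S.max'_mem hS)
  have hal : a ≤ (l : ℝ) := (h l (S.min'_mem hS)).1
  have hub : (u : ℝ) ≤ b := (h u (S.max'_mem hS)).2
  have hc : (S.card : ℝ) ≤ ((u + 1 - l : ℕ) : ℝ) := by exact_mod_cast hcard
  rw [Nat.cast_sub (by omega), Nat.cast_add, Nat.cast_one] at hc
  linarith

/-- **Chebyshev–pigeonhole–push, general carrier and centre.** Let `p ≥ 0` have total mass `1` on the finite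
carrier `s ⊆ ℕ`, second moment about `m` at most `V ≥ 0` on `s`, and ratio bounds `r * p j ≤ p (j + 1)`,
`r * p (j + 1) ≤ p j` for `lo ≤ j < hi` with `0 < r ≤ 1`, where `lo ≤ m - 2√V` and `m + 2√V ≤ hi`. Then
`3 / (4 (4√V + 2)) * r ^ (hi - lo) ≤ p k` for every `lo ≤ k ≤ hi`. -/
theorem c9_pointMass_ge_of_chebyshev_push' (s : Finset ℕ) (p : ℕ → ℝ) (hp0 : ∀ j, 0 ≤ p j)
    (hp1 : ∑ j ∈ s, p j = 1) {r : ℝ} (hr0 : 0 < r) (hr1 : r ≤ 1) {lo hi : ℕ}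
    (hratio : ∀ j, lo ≤ j → j < hi → r * p j ≤ p (j + 1) ∧ r * p (j + 1) ≤ p j) (m : ℝ) {V : ℝ}
    (hV0 : 0 ≤ V) (hV : ∑ j ∈ s, ((j : ℝ) - m) ^ 2 * p j ≤ V) (hlo : (lo : ℝ) ≤ m - 2 * Real.sqrt V)
    (hhi : m + 2 * Real.sqrt V ≤ hi) (k : ℕ) (hk : lo ≤ k) (hk' : k ≤ hi) :
    3 / (4 * (4 * Real.sqrt V + 2)) * r ^ (hi - lo) ≤ p k := by
  set S := s.filter (fun j : ℕ => |(j : ℝ) - m| ≤ 2 * Real.sqrt V) with hS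
  set T := s.filter (fun j : ℕ => 2 * Real.sqrt V < |(j : ℝ) - m|) with hT
  -- Step 1 (Chebyshev): the bulk `S` carries mass at least `3/4`.
  have hTle : ∑ j ∈ T, p j ≤ 1 / 4 := c9_chebyshev_tail_sum_le s p hp0 m hV0 hV
  have hST : ∑ j ∈ S, p j + ∑ j ∈ T, p j = 1 := by
    rw [← hp1]
    have h := Finset.sum_filter_add_sum_filter_not s (fun j : ℕ => |(j : ℝ) - m| ≤ 2 * Real.sqrt V) p
    simpa only [not_le] using h
  have hS34 : 3 / 4 ≤ ∑ j ∈ S, p j := by linarith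
  -- Step 2 (pigeonhole): some `k₀ ∈ S` has `p k₀ ≥ (3/4) / (4√V + 2)`.
  have hSne : S.Nonempty := by
    by_contra hne
    rw [Finset.not_nonempty_iff_eq_empty] at hne
    rw [hne, Finset.sum_empty] at hS34
    norm_num at hS34
  obtain ⟨k₀, hk₀S, hk₀max⟩ := Finset.exists_max_image S p hSne
  have hsum_le : ∑ j ∈ S, p j ≤ S.card • p k₀ := Finset.sum_le_card_nsmul S p (p k₀) hk₀max
  rw [nsmul_eq_mul] at hsum_le
  have hcard : (S.card : ℝ) ≤ 4 * Real.sqrt V + 2 := by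
    have hmem : ∀ j ∈ S, m - 2 * Real.sqrt V ≤ (j : ℝ) ∧ (j : ℝ) ≤ m + 2 * Real.sqrt V := by
      intro j hj
      have hj' : |(j : ℝ) - m| ≤ 2 * Real.sqrt V := (Finset.mem_filter.mp hj).2
      obtain ⟨h1, h2⟩ := abs_le.mp hj'
      constructor <;> linarith
    have h := c9_card_le_of_forall_mem_Icc S hSne hmem
    linarith
  have hk₀ge : 3 / (4 * (4 * Real.sqrt V + 2)) ≤ p k₀ := by
    rw [div_le_iff₀ (by positivity)]
    have h : 3 / 4 ≤ (4 * Real.sqrt V + 2) * p k₀ :=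
      calc 3 / 4 ≤ ∑ j ∈ S, p j := hS34
        _ ≤ S.card * p k₀ := hsum_le
        _ ≤ (4 * Real.sqrt V + 2) * p k₀ := mul_le_mul_of_nonneg_right hcard (hp0 k₀)
    linarith
  -- Step 3: `k₀` lies in the window `[lo, hi]`.
  have hk₀abs : |(k₀ : ℝ) - m| ≤ 2 * Real.sqrt V := (Finset.mem_filter.mp hk₀S).2
  obtain ⟨habs1, habs2⟩ := abs_le.mp hk₀abs
  have hk₀lo : lo ≤ k₀ := by
    have h : (lo : ℝ) ≤ k₀ := by linarith
    exact_mod_cast h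
  have hk₀hi : k₀ ≤ hi := by
    have h : (k₀ : ℝ) ≤ hi := by linarith
    exact_mod_cast h
  -- Step 4 (push): transport the bound from `k₀` to `k` along the ratio bounds.
  have hpush : r ^ (hi - lo) * p k₀ ≤ p k := by
    rcases le_or_gt k₀ k with hle | hlt
    · have h1 := c9_pow_mul_le_of_ratio_up p hr0.le (fun j hj hj' => (hratio j hj hj').1) hk₀lo (k - k₀)
        (by omega)
      rw [show k₀ + (k - k₀) = k by omega] at h1
      calc r ^ (hi - lo) * p k₀ ≤ r ^ (k - k₀) * p k₀ :=
          mul_le_mul_of_nonneg_right (pow_le_pow_of_le_one hr0.le hr1 (by omega)) (hp0 k₀)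
        _ ≤ p k := h1
    · have h1 := c9_pow_mul_le_of_ratio_down p hr0.le (fun j hj hj' => (hratio j hj hj').2) hk (k₀ - k)
        (by omega)
      rw [show k + (k₀ - k) = k₀ by omega] at h1
      calc r ^ (hi - lo) * p k₀ ≤ r ^ (k₀ - k) * p k₀ :=
          mul_le_mul_of_nonneg_right (pow_le_pow_of_le_one hr0.le hr1 (by omega)) (hp0 k₀)
        _ ≤ p k := h1
  calc 3 / (4 * (4 * Real.sqrt V + 2)) * r ^ (hi - lo) ≤ p k₀ * r ^ (hi - lo) :=
      mul_le_mul_of_nonneg_right hk₀ge (pow_nonneg hr0.le _)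
    _ = r ^ (hi - lo) * p k₀ := mul_comm _ _
    _ ≤ p k := hpush

/-- **Chebyshev–pigeonhole–push lower bound for a point mass of a law on `ℕ`** (registered stub, line `FirstLemma`).
For a law `p` on `ℕ` carried by `{0, …, K}` with mean `m̄ = ∑ i, i * p i`, variance at most `V`, and insertion-ratio
bounds `p (j+1) / p j ∈ [r, 1/r]` on a window `lo ≤ j < hi` with `lo ≤ m̄ - 2√V` and `m̄ + 2√V ≤ hi`
(`0 < r ≤ 1`), every `k ∈ [lo, hi]` has `p k ≥ 3 / (4 (4√V + 2)) * r ^ (hi - lo)`: Chebyshev puts mass `≥ 3/4`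
on the integers within `2√V` of the mean, pigeonhole gives one of them, `k₀`, with `p k₀ ≥ (3/4) / (4√V + 2)`,
and pushing from `k₀` to `k` along the ratio bounds costs at most `r ^ (hi - lo)`. (The hypothesis `hpK` is not
needed.) -/
theorem c9_pointMass_ge_of_chebyshev_push (K : ℕ) (p : ℕ → ℝ) (hp0 : ∀ j, 0 ≤ p j)
    (hp1 : ∑ j ∈ Finset.range (K + 1), p j = 1) (hpK : ∀ j, K < j → p j = 0) {r : ℝ} (hr0 : 0 < r)
    (hr1 : r ≤ 1) {lo hi : ℕ}
    (hratio : ∀ j, lo ≤ j → j < hi → r * p j ≤ p (j + 1) ∧ r * p (j + 1) ≤ p j) {V : ℝ} (hV0 : 0 ≤ V)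
    (hV : ∑ j ∈ Finset.range (K + 1), ((j : ℝ) - ∑ i ∈ Finset.range (K + 1), (i : ℝ) * p i) ^ 2 * p j ≤ V)
    (hlo : (lo : ℝ) ≤ (∑ i ∈ Finset.range (K + 1), (i : ℝ) * p i) - 2 * Real.sqrt V)
    (hhi : (∑ i ∈ Finset.range (K + 1), (i : ℝ) * p i) + 2 * Real.sqrt V ≤ hi) (k : ℕ) (hk : lo ≤ k)
    (hk' : k ≤ hi) : 3 / (4 * (4 * Real.sqrt V + 2)) * r ^ (hi - lo) ≤ p k := by
  have _ := hpK -- the support bound is part of the registered signature but not needed for the estimate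
  exact c9_pointMass_ge_of_chebyshev_push' (Finset.range (K + 1)) p hp0 hp1 hr0 hr1 hratio _ hV0 hV hlo hhi k
    hk hk'

end Summit.AtomisticToContinuum.HydrodynamicLimit.Theorems.KiferCompactification
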